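import Mathlib.LinearAlgebra.CrossProduct
import Mathlib.Data.Matrix.Mul
import Mathlib.LinearAlgebra.Matrix.Notation
import Literature.Analysis.FluidPDE.SixDirectionGeometricLemma
import HarnessLib

/-!
# The 27 direction families of De Lellis–Kwon 2022, §3.1: 270 pairwise non-colinear integer
# directions, each family a six-direction basis family plus an orthogonal frame

Analysis/FluidPDE support file on the discharge path of `Torus.DeLellisKwon2022_thm11`
(explicit data and decidable arithmetic; everything proved, no named facts). C. De Lellis, H. Kwon,
Anal. PDE 15 (2022) = arXiv:2006.06482, §3.1 (display after Lemma 3.3):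

> we choose 27 pairwise disjoint families `𝓕^j` indexed by `j ∈ ℤ₃³`, where each `𝓕^j` consists
> further of two (disjoint) subfamilies `𝓕^{j,R} ∪ 𝓕^{j,φ}` with cardinalities `|𝓕^{j,R}| = 6` and
> `|𝓕^{j,φ}| = 4`, chosen so that `𝓕^{j,R}` and `𝓕^{j,φ}` satisfy (3.3) and (3.4), respectively.
> For example, for `j = (0,0,0)` we can choose `𝓕^{j,R} = {(1,±1,0), (1,0,±1), (0,1,±1)}`,
> `𝓕^{j,φ} = {(1,2,0), (-2,1,0), (0,0,1), (1,-3,-1)}` and then we can apply 26 suitable rotations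
> (and rescalings),

and §6.2: "a family `𝓕 = ∪_j 𝓕^j ⊂ ℤ³ ∖ {0}` has been fixed ... and it consists of 270, pairwise
noncolinear, elements" — the property on which the choice of shifts (Lemma 6.1, Prop. 3.5) rests.
The paper fixes no explicit rotations; this file makes a CHOICE and verifies everything by
decidable integer arithmetic:

* `DLK.baseDir : Fin 10 → ℤ³` — the base family `𝓕⁰` (the six directions `DLK.sixDir` of
  `SixDirectionGeometricLemma` followed by the frame `(1,2,0), (-2,1,0), (0,0,1), (1,-3,-1)`);
* `DLK.rot : Fin 27 → Matrix (Fin 3) (Fin 3) ℤ` — 27 integer matrices (the identity and 26 scaled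
  rotations from integer quaternions of norm `5, 7, 10, 13`), with `DLK.rotScale j ∈ {1,5,7,10,13}`
  and **`A Aᵀ = AᵀA = n² Id`** (`DLK.rot_mul_transpose`, `DLK.transpose_mul_rot`);
* `DLK.dir (j, i) = rot j *ᵥ baseDir i` — **the 270 directions**, and the theorems:
  `DLK.dir_cross_ne_zero` — **pairwise non-colinear** (`dir p × dir q ≠ 0` for `p ≠ q`, hence
  `dir p ≠ 0`); `DLK.sum_dir_six` — **(3.3)** for each `𝓕^{j,R}`: `∑_{i<6} (dir (j,i))_a (dir (j,i))_b
  = 4 n_j² δ_ab` (the basis property transfers from `DLK.eq_sixCoeffSq_of_sum_eq` through the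
  invertible congruence `M ↦ A M Aᵀ`); `DLK.dir_frame_orthogonal`, `DLK.dir_frame_sum` — **(3.4)**
  for each `𝓕^{j,φ}`: `dir (j,6), dir (j,7), dir (j,8)` pairwise orthogonal and
  `dir (j,9) = -(dir (j,6) + dir (j,7) + dir (j,8))`.

## Mathlib / tree search

Mathlib: `crossProduct` (`⨯₃`, `cross_apply`), `Matrix.mulVec`, `dotProduct`, `decide +kernel`.
Tree: `DLK.sixDir` (`SixDirectionGeometricLemma`); `MikadoDisjointPipes` (cross products of the
fifteen Nash directions by `decide`). Nothing on DLK's 27 families (`lean search 'rotScale|27 famil'`).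

## References

* C. De Lellis, H. Kwon, Anal. PDE 15 (2022) = arXiv:2006.06482, §3.1 (the families `𝓕^{j,R}`,
  `𝓕^{j,φ}`, (3.3), (3.4)), §6.2 ("270, pairwise noncolinear, elements"). [DelellisKwon2022]
-/

namespace Literature.Analysis.FluidPDE

namespace DLK

open Matrix

/-! ## Data -/

/-- The base family `𝓕⁰`: `(1,±1,0), (1,0,±1), (0,1,±1)` (`= DLK.sixDir`) followed by the frame
`(1,2,0), (-2,1,0), (0,0,1), (1,-3,-1)`. [cite: DelellisKwon2022, §3.1 (display after Lemma 3.3)] -/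
def baseDir : Fin 10 → Fin 3 → ℤ :=
  ![![1, 1, 0], ![1, -1, 0], ![1, 0, 1], ![1, 0, -1], ![0, 1, 1], ![0, 1, -1],
    ![1, 2, 0], ![-2, 1, 0], ![0, 0, 1], ![1, -3, -1]]

/-- The first six base directions are `DLK.sixDir`. [folklore] -/
theorem baseDir_castLE (i : Fin 6) : baseDir (Fin.castLE (by norm_num) i) = sixDir i := by
  fin_cases i <;> rfl

/-- The 27 integer matrices `A_j` (a CHOICE realising "26 suitable rotations and rescalings"):
`A₀ = Id` and 26 scaled rotations `A = n R`, `R ∈ SO(3, ℚ)`, from integer quaternions of norm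
`n ∈ {5, 7, 10, 13}`. [cite: DelellisKwon2022, §3.1 ("26 suitable rotations (and rescalings)")] -/
def rot : Fin 27 → Matrix (Fin 3) (Fin 3) ℤ :=
  ![!![1, 0, 0; 0, 1, 0; 0, 0, 1],
    !![5, 0, 0; 0, 3, -4; 0, 4, 3],
    !![3, 0, 4; 0, 5, 0; -4, 0, 3],
    !![3, 0, -4; 0, 5, 0; 4, 0, 3],
    !![5, 0, 0; 0, 3, 4; 0, -4, 3],
    !![3, -2, 6; 6, 3, -2; -2, 6, 3],
    !![3, 6, 2; -2, 3, -6; -6, 2, 3],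
    !![3, -6, -2; 2, 3, -6; 6, 2, 3],
    !![3, 2, -6; -6, 3, -2; 2, 6, 3],
    !![3, -6, 2; 2, 3, 6; -6, -2, 3],
    !![3, 2, 6; -6, 3, 2; -2, -6, 3],
    !![3, -2, -6; 6, 3, 2; 2, -6, 3],
    !![3, 6, -2; -2, 3, 6; 6, -2, 3],
    !![6, 0, 8; 8, 0, -6; 0, 10, 0],
    !![6, 0, -8; -8, 0, -6; 0, 10, 0],
    !![13, 0, 0; 0, 5, -12; 0, 12, 5],
    !![5, 0, 12; 0, 13, 0; -12, 0, 5],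
    !![5, 0, -12; 0, 13, 0; 12, 0, 5],
    !![13, 0, 0; 0, 5, 12; 0, -12, 5],
    !![3, 4, 12; 12, 3, -4; -4, 12, -3],
    !![3, 12, 4; 4, 3, -12; -12, 4, -3],
    !![3, -4, 12; 12, -3, -4; 4, 12, 3],
    !![3, 12, -4; -4, -3, -12; -12, 4, 3],
    !![3, -12, 4; 4, -3, -12; 12, 4, 3],
    !![3, 4, -12; -12, -3, -4; -4, 12, 3],
    !![3, -12, -4; -4, 3, -12; 12, 4, -3],
    !![3, -4, -12; -12, 3, -4; 4, 12, -3]]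

/-- The scales `n_j` with `A_j A_jᵀ = n_j² Id`. [folklore] -/
def rotScale : Fin 27 → ℤ :=
  ![1, 5, 5, 5, 5, 7, 7, 7, 7, 7, 7, 7, 7, 10, 10, 13, 13, 13, 13, 13, 13, 13, 13, 13, 13, 13, 13]

/-- The scales are positive. [folklore] -/
theorem rotScale_pos (j : Fin 27) : 0 < rotScale j := by
  fin_cases j <;> decide

/-! ## Decidable-arithmetic kernels (sum-free, for fast kernel evaluation) -/

/-- `u · v` for integer `3`-vectors, written out. [folklore] -/
def dot3 (u v : Fin 3 → ℤ) : ℤ := u 0 * v 0 + u 1 * v 1 + u 2 * v 2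

/-- `dot3 = dotProduct`. [folklore] -/
theorem dot3_eq (u v : Fin 3 → ℤ) : dot3 u v = u ⬝ᵥ v := by
  simp [dot3, dotProduct, Fin.sum_univ_three]

/-- `A v` for an integer `3 × 3` matrix, written out. [folklore] -/
def mulVec3 (A : Matrix (Fin 3) (Fin 3) ℤ) (v : Fin 3 → ℤ) : Fin 3 → ℤ :=
  ![dot3 (A 0) v, dot3 (A 1) v, dot3 (A 2) v]

/-- `mulVec3 = Matrix.mulVec`. [folklore] -/
theorem mulVec3_eq (A : Matrix (Fin 3) (Fin 3) ℤ) (v : Fin 3 → ℤ) : mulVec3 A v = A *ᵥ v := by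
  funext i
  fin_cases i <;> simp [mulVec3, Matrix.mulVec, dot3_eq]

/-- `u × v`, written out. [folklore] -/
def cross3 (u v : Fin 3 → ℤ) : Fin 3 → ℤ :=
  ![u 1 * v 2 - u 2 * v 1, u 2 * v 0 - u 0 * v 2, u 0 * v 1 - u 1 * v 0]

/-- `cross3 = crossProduct`. [folklore] -/
theorem cross3_eq (u v : Fin 3 → ℤ) : cross3 u v = crossProduct u v := by
  rw [cross_apply]; rfl

/-! ## The 270 directions -/

/-- **The direction family** `𝓕 = ∪_j 𝓕^j`: `dir (j, i) = A_j (baseDir i)`; `i < 6` gives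
`𝓕^{j,R}`, `6 ≤ i` gives `𝓕^{j,φ}`. [cite: DelellisKwon2022, §3.1] -/
def dir (p : Fin 27 × Fin 10) : Fin 3 → ℤ := mulVec3 (rot p.1) (baseDir p.2)

/-- `dir (j, i) = A_j *ᵥ baseDir i`. [folklore] -/
theorem dir_eq_mulVec (j : Fin 27) (i : Fin 10) : dir (j, i) = rot j *ᵥ baseDir i :=
  mulVec3_eq _ _

/-- **`A_j A_jᵀ = n_j² Id`** (the matrices are scaled rotations). [folklore] -/
theorem rot_mul_transpose (j : Fin 27) : rot j * (rot j)ᵀ = (rotScale j ^ 2 : ℤ) • (1 : Matrix (Fin 3) (Fin 3) ℤ) := by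
  fin_cases j <;> decide

/-- **`A_jᵀ A_j = n_j² Id`**. [folklore] -/
theorem transpose_mul_rot (j : Fin 27) : (rot j)ᵀ * rot j = (rotScale j ^ 2 : ℤ) • (1 : Matrix (Fin 3) (Fin 3) ℤ) := by
  fin_cases j <;> decide

/-- `u × u = 0`. [folklore] -/
theorem cross3_self (u : Fin 3 → ℤ) : cross3 u u = 0 := by
  funext i
  fin_cases i <;> simp [cross3] <;> ring

/-- Flat indexing of the 270 directions: `tbl (10 j + i) = dir (j, i)`. [folklore] -/
def tbl (a : ℕ) : Fin 3 → ℤ := dir (Fin.ofNat 27 (a / 10), Fin.ofNat 10 (a % 10))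

/-- `tbl (10 j + i) = dir (j, i)`. [folklore] -/
theorem tbl_eq (j : Fin 27) (i : Fin 10) : tbl (10 * j + i) = dir (j, i) := by
  unfold tbl
  have hj : Fin.ofNat 27 ((10 * (j : ℕ) + i) / 10) = j := by
    apply Fin.ext
    rw [Fin.val_ofNat]
    have : (10 * (j : ℕ) + i) / 10 = j := by omega
    rw [this, Nat.mod_eq_of_lt j.isLt]
  have hi : Fin.ofNat 10 ((10 * (j : ℕ) + i) % 10) = i := by
    apply Fin.ext
    rw [Fin.val_ofNat]
    have : (10 * (j : ℕ) + i) % 10 = i := by omega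
    rw [this, Nat.mod_eq_of_lt i.isLt]
  rw [hj, hi]

/-- The indexed table of the 270 directions. [folklore] -/
def tblList : List (ℕ × (Fin 3 → ℤ)) := (List.range 270).map fun a => (a, tbl a)

/-- The Boolean certificate: every pair of distinct indices has a nonzero cross product. [folklore] -/
def checkPairs : Bool :=
  tblList.all fun au => tblList.all fun bv => au.1 == bv.1 || !(cross3 au.2 bv.2 == 0)

/-- **The certificate evaluates to `true`** (kernel computation over the 72 900 pairs). [folklore] -/
theorem checkPairs_eq_true : checkPairs = true := by
  decide +kernel

/-- **The 270 directions are pairwise non-colinear**: `dir p × dir q ≠ 0` for `p ≠ q`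
(§6.2: "270, pairwise noncolinear, elements"). [cite: DelellisKwon2022, §6.2] -/
theorem dir_cross3_ne_zero : ∀ p q : Fin 27 × Fin 10, p ≠ q → cross3 (dir p) (dir q) ≠ 0 := by
  intro p q hpq
  obtain ⟨j, i⟩ := p
  obtain ⟨j', i'⟩ := q
  have h := checkPairs_eq_true
  rw [checkPairs, List.all_eq_true] at h
  have ha : (10 * (j : ℕ) + i, tbl (10 * j + i)) ∈ tblList := by
    rw [tblList, List.mem_map]
    exact ⟨10 * j + i, List.mem_range.2 (by omega), rfl⟩
  have hb : (10 * (j' : ℕ) + i', tbl (10 * j' + i')) ∈ tblList := by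
    rw [tblList, List.mem_map]
    exact ⟨10 * j' + i', List.mem_range.2 (by omega), rfl⟩
  have h2 := h _ ha
  rw [List.all_eq_true] at h2
  have h3 := h2 _ hb
  simp only [Bool.or_eq_true, beq_iff_eq, Bool.not_eq_true', beq_eq_false_iff_ne, ne_eq] at h3
  rw [tbl_eq, tbl_eq] at h3
  rcases h3 with h3 | h3
  · exfalso
    apply hpq
    have hj : (j : ℕ) = j' := by omega
    have hi : (i : ℕ) = i' := by omega
    rw [Prod.mk.injEq]
    exact ⟨Fin.ext hj, Fin.ext hi⟩
  · exact h3

/-- Non-colinearity with Mathlib's cross product. [cite: DelellisKwon2022, §6.2] -/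
theorem dir_cross_ne_zero {p q : Fin 27 × Fin 10} (h : p ≠ q) : crossProduct (dir p) (dir q) ≠ 0 := by
  rw [← cross3_eq]; exact dir_cross3_ne_zero p q h

/-- `dir` is injective. [folklore] -/
theorem dir_injective : Function.Injective dir := fun p q h => by
  by_contra hne
  exact dir_cross3_ne_zero p q hne (by rw [h, cross3_self])

/-! ## (3.3) for the six-direction subfamilies -/

/-- **`∑_{i<6} f ⊗ f = 4 n_j² Id` for `𝓕^{j,R}`** ((3.3) with `C = 4n_j²`). [cite: DelellisKwon2022, §3.1 (3.3)] -/
theorem sum_dir_six (j : Fin 27) (a b : Fin 3) :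
    ∑ i : Fin 6, dir (j, Fin.castLE (by norm_num) i) a * dir (j, Fin.castLE (by norm_num) i) b =
      4 * rotScale j ^ 2 * (if a = b then 1 else 0) := by
  fin_cases j <;> fin_cases a <;> fin_cases b <;> decide

/-! ## (3.4) for the frame subfamilies -/

/-- **The frame directions are pairwise orthogonal** ((3.4), first part). [cite: DelellisKwon2022, §3.1 (3.4)] -/
theorem dir_frame_orthogonal (j : Fin 27) :
    dot3 (dir (j, 6)) (dir (j, 7)) = 0 ∧ dot3 (dir (j, 6)) (dir (j, 8)) = 0 ∧ dot3 (dir (j, 7)) (dir (j, 8)) = 0 := by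
  fin_cases j <;> decide

/-- **`f₄ = -(f₁ + f₂ + f₃)`** for every frame subfamily ((3.4), second part). [cite: DelellisKwon2022, §3.1 (3.4)] -/
theorem dir_frame_sum (j : Fin 27) : dir (j, 9) = -(dir (j, 6) + dir (j, 7) + dir (j, 8)) := by
  fin_cases j <;> decide

/-- The frame directions have (Euclidean) length `≥ 1`, indeed squared length `≥ 1` (they are
nonzero integer vectors). [folklore] -/
theorem one_le_dot3_dir_self (p : Fin 27 × Fin 10) : 1 ≤ dot3 (dir p) (dir p) := by
  obtain ⟨j, i⟩ := p
  fin_cases j <;> fin_cases i <;> decide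

/-- All directions are nonzero (`𝓕 ⊂ ℤ³ ∖ {0}`). [cite: DelellisKwon2022, §3.1] -/
theorem dir_ne_zero (p : Fin 27 × Fin 10) : dir p ≠ 0 := fun h => by
  have := one_le_dot3_dir_self p
  rw [h] at this
  simp [dot3] at this

end DLK

end Literature.Analysis.FluidPDE
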